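import Literature.MathematicalPhysics.QuantumFieldTheory.Balaban1983to89.B3Bound316
import Literature.MathematicalPhysics.QuantumFieldTheory.Balaban1983to89.B3CxiTorusBound

/-!
# `Balaban1983to89.B3Bound316Cxi` — T. Bałaban, *(Higgs)₂,₃ quantum fields in a finite volume. III. Renormalization*, Commun. Math.
Phys. **88** (1983) 411–445 [Balaban1983Higgs3], p. 437 [PDF 27]: the two steps of the analysis of (3.16) — its ASSEMBLY from (3.15)
(*"Σ_{ν=1}^d ∂^ξ_νC^ξ∂^{ξ*}_ν = −Δ^ξC^ξ = δ^ξ − C^ξ"*) and its ESTIMATE BY A CONSTANT — made UNCONDITIONAL IN THE FREE PROPAGATOR: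
the hypotheses on `C^ξ` of r15's `B3Sect3ScalarSelfEnergy.eq316_bracket` and of p20's `B3Bound316.abs_bracket316_le` are DISCHARGED
for the actual free propagator of the torus `C^ξ_T = (−Δ^ξ_T + 1)^{−1}` (p03 g3's `B3CxiTorusBound.CxiT`)

statement-level skeleton of published theorems with citation tags; proofs where landed; nothing here is a claim about the Yang–Mills mass gap

PDF held: `paper:balaban1983-higgs-2-3-quantum-fields-finite-volume` (journal page = PDF page + 410); p. 437 read in the OCR text `p0027.txt`
and on the render `run/shared/lean/pub/pub-balaban/b2b-balaban-ref1/pages/1983-cmp88-higgs23-III/1983-cmp88-higgs23-III-p027-x4.png`.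

CITATION HEADER (lean-in-tree rule).  Part of the lit-balaban TYPED SKELETON (HOME `run/shared/lean/pub/lit-balaban/`), PHASE 2, seat p20
generation 4.  WHAT IS REPRODUCED: row **B3.Eq3.11-3.17** of `HOME/lit-balaban-r15/ROWS-B3.md` (fold owner r15), sub-display (3.16)
and the sentence after it.  Inputs (all ACCEPTED, imported): r15's `B3Sect3ScalarSelfEnergy` (p246479: `bracket315`, `bracket316`,
`eq316_bracket` — the assembly of (3.16) under the KERNEL HYPOTHESIS `hC : Σ_ν(∂^ξ_νC∂^{ξ*}_ν)(y,y′) = δ^ξ(y,y′) − C(y,y′)`), p20 g2's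
`B3Bound316` (p248769: `abs_bracket316_le` — *"we can estimate (3.16) by a constant"* under the KERNEL BOUND `hC : |C^ξ(y,y′)| ≤
A e^{−δ|y−y′|}/|y−y′|`), p03 g3's `B3CxiTorusBound` (p251987/p252272: the torus free propagator `CxiT ξ` = periodization of the
momentum-integral `C^ξ` of ξℤ^d, its kernel equation `laplace_CxiT_add` — (−Δ^ξ_T + 1)C^ξ_T(·,y′) = ξ^{−d}δ_{y′} — and the printed kernel
bound `CxiT_hC` : |C^ξ_T(y,y′)| ≤ `torusConst`·e^{−½ξ|y−y′|_∞}/(ξ|y−y′|_∞) for d = 3, 0 < ξ ≤ 1, 1 ≤ ξN).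

THE PRINTED TEXT (verbatim, p. 437).  *"Next we replace G^ξ_{j″}(0) by C^ξ = (−Δ^ξ + 1)^{−1}: G^ξ_{j″}(0) = C^ξ + G^ξ_{j″}(0)(1 − m²_{j″} −
a_{j″}P_{j″})C^ξ. We have Σ_{ν=1}^d ∂^ξ_νC^ξ∂^{ξ*}_ν = −Δ^ξC^ξ = δ^ξ − C^ξ and δ^ξ(y′ − y)(y′_μ − y_μ) = 0, so the expression is equal to
[(3.16)]. Using the inequalities |C^ξ(y − y′)| ≦ O(1)e^{−½|y−y′|}/|y − y′|, |G^ξ_{j″}(0; y, y′)| ≦ O(1)e^{−δ₀|y−y′|}/|y − y′|, and the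
corresponding inequalities for derivatives, we can estimate (3.16) by a constant."*

WHAT IS PROVED, and how.  For the torus free propagator `C = CxiT ξ` (`ξ > 0`):
* `sum_dKernel_CxiT` — **"Σ_ν ∂^ξ_νC^ξ∂^{ξ*}_ν = −Δ^ξC^ξ = δ^ξ − C^ξ" AS KERNELS ON THE TORUS**: `Σ_ν(∂^ξ_νC^ξ_T∂^{ξ*}_ν)(y,y′) =
  ξ^{−d}[y′ = y] − C^ξ_T(y,y′)` (translation invariance `CxiT_shift_shift` turns r15's `dKernel` into `LatticeFieldCalculus.laplace`
  acting on the first variable; then p03's `laplace_CxiT_add`) — exactly the hypothesis `hC` of r15's `eq316_bracket`;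
* `eq316_bracket_CxiT`, `expr315_eq_bracket316_CxiT` — the assembly of (3.16) from (3.15) with that hypothesis DISCHARGED (the
  resolvent split `G^ξ_{j″}(0) = C^ξ_T + M` stays the printed input, `eq316_resolvent`);
* `abs_bracket316_CxiT_le` (+ `_uniform`, `_disp`) — *"we can estimate (3.16) by a constant"* in d = 3 with the free-propagator bound
  DISCHARGED by p03's `CxiT_hC` (δ = ½, A = `torusConst`; the bounds on `G^ξ_{j″}(0)` and on the derivative kernel of `M` = rows
  B3.Eq2.10–2.12 / [Balaban1982Higgs1] Props. 2.1, 2.3 stay hypotheses, as printed "using the inequalities …");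
* `abs_bracket315_CxiT_le` — both steps chained: the (3.15) bracket on the ξ-lattice, for `G^ξ_{j″}(0) = C^ξ_T + M`, is bounded by the
  constant `3B(torusConst·R₁ + 3B′R₂)`, `R_p = B3Bound316.radialConst 3 ½ ξ p`, uniformly in the volume (and in ξ ≤ 1 at ξ = 1).
D-0026: theorems only, no `def`, no named fact; standard axioms.  Unit `lit-balaban-p20` (literature-prover-lit-balaban-p20-g4-0), 2026-08-21.
-/

open scoped BigOperators

namespace Literature.MathematicalPhysics.QuantumFieldTheory.Balaban1983to89.B3Bound316Cxi

open LatticeFieldCalculus B3Sect3ScalarSelfEnergy B3Taylor310Remainder B3TorusRadialSums B3Bound316 B3CxiTorusBound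

noncomputable section

variable {P : Params} {j : ℕ}

/-! ## 1. "Σ_ν ∂^ξ_νC^ξ∂^{ξ*}_ν = −Δ^ξC^ξ = δ^ξ − C^ξ" for the torus free propagator, as kernels -/

/-- kernel: `(y − e_μ) + e_μ = y`. [folklore] -/
private theorem shift_unshift' (y : Site P j) (μ : Fin P.d) : (y.unshift μ).shift μ = y :=
  (shiftEquiv (P := P) (j := j) μ).apply_symm_apply y

/-- kernel: `(y + e_μ) − e_μ = y`. [folklore] -/
private theorem unshift_shift' (y : Site P j) (μ : Fin P.d) : (y.shift μ).unshift μ = y :=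
  (shiftEquiv (P := P) (j := j) μ).symm_apply_apply y

/-- kernel: translation invariance of `C^ξ_T` in the form `C^ξ_T(y, y′ + e_μ) = C^ξ_T(y − e_μ, y′)`. [cite: Balaban1983Higgs3, (3.16) p.437] -/
private theorem CxiT_shift_right (ξ : ℝ) (y y' : Site P j) (μ : Fin P.d) :
    CxiT ξ y (y'.shift μ) = CxiT ξ (y.unshift μ) y' := by
  conv_lhs => rw [← shift_unshift' y μ]
  exact CxiT_shift_shift ξ (y.unshift μ) y' μ

/-- **p. 437: "Σ_{ν=1}^d ∂^ξ_νC^ξ∂^{ξ*}_ν = −Δ^ξC^ξ"** for the torus free propagator, as kernels: the sum over `ν` of r15's kernels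
`(∂^ξ_νC^ξ_T∂^{ξ*}_ν)(y,y′)` is `(−Δ^ξ_T)` acting on the first variable of `C^ξ_T` (translation invariance).
[cite: Balaban1983Higgs3, (3.16) p.437] -/
theorem sum_dKernel_CxiT_eq_laplace (ξ : ℝ) (y y' : Site P j) :
    ∑ ν : Fin P.d, dKernel ξ⁻¹ ν (CxiT ξ) y y' = laplace ξ⁻¹ (fun x => CxiT ξ x y') y := by
  simp only [dKernel, laplace, CxiT_shift_right, unshift_shift', smul_eq_mul]
  exact Finset.sum_congr rfl fun ν _ => by ring

/-- **p. 437: "Σ_{ν=1}^d ∂^ξ_νC^ξ∂^{ξ*}_ν = −Δ^ξC^ξ = δ^ξ − C^ξ"** for the torus free propagator `C^ξ_T = (−Δ^ξ_T + 1)^{−1}`, AS KERNELS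
with respect to `Σ_{y′}ξ^d` (`δ^ξ(y,y′) = ξ^{−d}[y′ = y]`): exactly the hypothesis `hC` of r15's `B3Sect3ScalarSelfEnergy.eq316_bracket`,
now a theorem (p03's kernel equation `laplace_CxiT_add`). [cite: Balaban1983Higgs3, (3.16) p.437] -/
theorem sum_dKernel_CxiT {ξ : ℝ} (hξ : 0 < ξ) (y y' : Site P j) :
    ∑ ν : Fin P.d, dKernel ξ⁻¹ ν (CxiT ξ) y y' = (if y' = y then (ξ ^ P.d)⁻¹ else 0) - CxiT ξ y y' := by
  rw [sum_dKernel_CxiT_eq_laplace, eq_sub_iff_add_eq, laplace_CxiT_add hξ, inv_pow]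
  simp only [eq_comm]

/-! ## 2. The assembly of (3.16) with the free-propagator hypothesis discharged -/

/-- **(3.16) p. 437, ASSEMBLY, free-propagator input discharged**: if the resummed propagator on the ξ-lattice splits as
`G^ξ_{j″}(0) = C^ξ_T + M` (`hG0`; the resolvent identity `eq316_resolvent`, `M` = the kernel of `G^ξ_{j″}(0)(1−m²_{j″}−a_{j″}P_{j″})C^ξ_T`)
and the coordinate difference vanishes on the diagonal (`hdx`), then the bracket of (3.15) equals the bracket of (3.16) with `C = C^ξ_T` —
r15's `eq316_bracket` with its hypothesis `hC` supplied by `sum_dKernel_CxiT`. [cite: Balaban1983Higgs3, (3.16) p.437] -/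
theorem eq316_bracket_CxiT {ξ : ℝ} (hξ : 0 < ξ) (G0 M G : Kernel P j) (g g' : SiteField P j ℝ)
    (dx : Fin P.d → Site P j → Site P j → ℝ) (μ : Fin P.d) (hG0 : G0 = fun y y' => CxiT ξ y y' + M y y')
    (hdx : ∀ y : Site P j, dx μ y y = 0) (y : Site P j) :
    bracket315 ξ G0 G g g' dx μ y = bracket316 ξ (CxiT ξ) M G g g' dx μ y :=
  eq316_bracket ξ G0 (CxiT ξ) M G g g' dx μ hG0 (sum_dKernel_CxiT hξ) hdx y

/-- The same at the level of the whole expression (3.15): `−Σ_μΣ_yξ^dφ(y)·[bracket of (3.16) with C^ξ_T]q²(∂^ξ_μφ′)(y)` — r15's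
`expr315_eq_bracket316` with `hC` discharged. [cite: Balaban1983Higgs3, (3.16) p.437] -/
theorem expr315_eq_bracket316_CxiT {W : Type*} [NormedAddCommGroup W] [InnerProductSpace ℝ W] {ξ : ℝ} (hξ : 0 < ξ)
    (q : W →ₗ[ℝ] W) (G0 M G : Kernel P j) (g g' : SiteField P j ℝ) (dx : Fin P.d → Site P j → Site P j → ℝ) (φ : SiteField P j W)
    (D : Fin P.d → SiteField P j W) (hG0 : G0 = fun y y' => CxiT ξ y y' + M y y') (hdx : ∀ (μ : Fin P.d) (y : Site P j), dx μ y y = 0) :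
    expr315 ξ q G0 G g g' dx φ D =
      -∑ μ : Fin P.d, ∑ y : Site P j, ξ ^ P.d * (bracket316 ξ (CxiT ξ) M G g g' dx μ y * inner ℝ (φ y) (q (q (D μ y)))) :=
  expr315_eq_bracket316 ξ q G0 (CxiT ξ) M G g g' dx φ D hG0 (sum_dKernel_CxiT hξ) hdx

/-! ## 3. "(3.16) estimated by a constant" with the free-propagator bound discharged (d = 3) -/

/-- **p. 437, "we can estimate (3.16) by a constant" — with `|C^ξ(y − y′)| ≦ O(1)e^{−½|y−y′|}/|y − y′|` DISCHARGED** for the torus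
free propagator (p03's `CxiT_hC`: `d = 3`, `0 < ξ ≤ 1`, `1 ≤ ξN`, `O(1) = torusConst`): under the remaining printed kernel bounds — on
`G^ξ_{j″}(y,y′)` (`hG`, rate ½) and on the derivative kernel `(∂^ξ_νM∂^{ξ*}_ν)(y,y′)` (`hM`, *"the corresponding inequalities for
derivatives"*) — and `|g|, |g′| ≤ 1`, `|dx_μ(y,y′)| ≤ ξ|y − y′|₁`, for EVERY `y`:
`|[(3.16)](y)| ≤ 3B·(torusConst·R₁ + 3B′·R₂)`, `R_p = radialConst 3 ½ ξ p`, uniformly in the volume. [cite: Balaban1983Higgs3, (3.16) p.437] -/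
theorem abs_bracket316_CxiT_le (hd : P.d = 3) {ξ : ℝ} (hξ : 0 < ξ) (hξ1 : ξ ≤ 1) (hN : 1 ≤ ξ * (P.sitesPerDir j : ℝ))
    {B B' : ℝ} (hB : 0 ≤ B) (hB' : 0 ≤ B') (M G : Kernel P j) (g g' : SiteField P j ℝ)
    (dx : Fin P.d → Site P j → Site P j → ℝ) (μ : Fin P.d)
    (hM : ∀ (ν : Fin P.d) (y y' : Site P j), y' ≠ y →
      |dKernel ξ⁻¹ ν M y y'| ≤ B' * ((ξ * supDist y y') ^ 2)⁻¹ * Real.exp (-(1 / 2 * (ξ * supDist y y'))))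
    (hG : ∀ y y' : Site P j, y' ≠ y → |G y y'| ≤ B * (ξ * supDist y y')⁻¹ * Real.exp (-(1 / 2 * (ξ * supDist y y'))))
    (hg : ∀ y, |g y| ≤ 1) (hg' : ∀ y, |g' y| ≤ 1)
    (hdx : ∀ y y' : Site P j, |dx μ y y'| ≤ ξ * Site.tdist y y') (y : Site P j) :
    |bracket316 ξ (CxiT ξ) M G g g' dx μ y| ≤
      P.d * B * (torusConst * radialConst P.d (1 / 2) ξ 1 + P.d * B' * radialConst P.d (1 / 2) ξ 0) :=
  abs_bracket316_le hd hξ (by norm_num) torusConst_nonneg hB hB' (CxiT ξ) M G g g' dx μ (CxiT_hC hd hξ hξ1 hN) hM hG hg hg' hdx y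

/-- The same bound UNIFORM in the lattice spacing `0 < ξ ≤ 1` (the constant at `ξ = 1`). [cite: Balaban1983Higgs3, (3.16) p.437] -/
theorem abs_bracket316_CxiT_le_uniform (hd : P.d = 3) {ξ : ℝ} (hξ : 0 < ξ) (hξ1 : ξ ≤ 1) (hN : 1 ≤ ξ * (P.sitesPerDir j : ℝ))
    {B B' : ℝ} (hB : 0 ≤ B) (hB' : 0 ≤ B') (M G : Kernel P j) (g g' : SiteField P j ℝ)
    (dx : Fin P.d → Site P j → Site P j → ℝ) (μ : Fin P.d)
    (hM : ∀ (ν : Fin P.d) (y y' : Site P j), y' ≠ y →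
      |dKernel ξ⁻¹ ν M y y'| ≤ B' * ((ξ * supDist y y') ^ 2)⁻¹ * Real.exp (-(1 / 2 * (ξ * supDist y y'))))
    (hG : ∀ y y' : Site P j, y' ≠ y → |G y y'| ≤ B * (ξ * supDist y y')⁻¹ * Real.exp (-(1 / 2 * (ξ * supDist y y'))))
    (hg : ∀ y, |g y| ≤ 1) (hg' : ∀ y, |g' y| ≤ 1)
    (hdx : ∀ y y' : Site P j, |dx μ y y'| ≤ ξ * Site.tdist y y') (y : Site P j) :
    |bracket316 ξ (CxiT ξ) M G g g' dx μ y| ≤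
      P.d * B * (torusConst * radialConst P.d (1 / 2) 1 1 + P.d * B' * radialConst P.d (1 / 2) 1 0) :=
  abs_bracket316_le_uniform hd hξ hξ1 (by norm_num) torusConst_nonneg hB hB' (CxiT ξ) M G g g' dx μ (CxiT_hC hd hξ hξ1 hN)
    hM hG hg hg' hdx y

/-- The same bound for the PRINTED displacement `dx_μ(y,y′) = (y′_μ − y_μ)` along `Γ_{y,y′}` (`B3Taylor310Remainder.disp ξ⁻¹`).
[cite: Balaban1983Higgs3, (3.16) p.437] -/
theorem abs_bracket316_CxiT_le_disp (hd : P.d = 3) {ξ : ℝ} (hξ : 0 < ξ) (hξ1 : ξ ≤ 1) (hN : 1 ≤ ξ * (P.sitesPerDir j : ℝ))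
    {B B' : ℝ} (hB : 0 ≤ B) (hB' : 0 ≤ B') (M G : Kernel P j) (g g' : SiteField P j ℝ) (μ : Fin P.d)
    (hM : ∀ (ν : Fin P.d) (y y' : Site P j), y' ≠ y →
      |dKernel ξ⁻¹ ν M y y'| ≤ B' * ((ξ * supDist y y') ^ 2)⁻¹ * Real.exp (-(1 / 2 * (ξ * supDist y y'))))
    (hG : ∀ y y' : Site P j, y' ≠ y → |G y y'| ≤ B * (ξ * supDist y y')⁻¹ * Real.exp (-(1 / 2 * (ξ * supDist y y'))))
    (hg : ∀ y, |g y| ≤ 1) (hg' : ∀ y, |g' y| ≤ 1) (y : Site P j) :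
    |bracket316 ξ (CxiT ξ) M G g g' (fun μ y y' => disp ξ⁻¹ y y' μ) μ y| ≤
      P.d * B * (torusConst * radialConst P.d (1 / 2) ξ 1 + P.d * B' * radialConst P.d (1 / 2) ξ 0) :=
  abs_bracket316_le_disp hd hξ (by norm_num) torusConst_nonneg hB hB' (CxiT ξ) M G g g' μ (CxiT_hC hd hξ hξ1 hN) hM hG hg hg' y

/-! ## 4. Both steps chained: the (3.15) bracket on the ξ-lattice is bounded by a constant -/

/-- **p. 437, the two steps chained**: on the ξ-lattice `T^{(j)}_ξ` (d = 3, `0 < ξ ≤ 1`, `1 ≤ ξN`), if the resummed propagator splits by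
the resolvent identity as `G^ξ_{j″}(0) = C^ξ_T + M` and the printed kernel bounds hold for `G^ξ_{j″}` and for the derivative kernel of `M`,
then the coefficient in the vertex of (3.15) — *"the expression in the square brackets in (3.15)"* — is bounded by the constant
`3B(torusConst·R₁ + 3B′R₂)` for every `y` and `μ`, uniformly in the volume. [cite: Balaban1983Higgs3, (3.16) p.437] -/
theorem abs_bracket315_CxiT_le (hd : P.d = 3) {ξ : ℝ} (hξ : 0 < ξ) (hξ1 : ξ ≤ 1) (hN : 1 ≤ ξ * (P.sitesPerDir j : ℝ))
    {B B' : ℝ} (hB : 0 ≤ B) (hB' : 0 ≤ B') (G0 M G : Kernel P j) (g g' : SiteField P j ℝ)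
    (dx : Fin P.d → Site P j → Site P j → ℝ) (μ : Fin P.d) (hG0 : G0 = fun y y' => CxiT ξ y y' + M y y')
    (hM : ∀ (ν : Fin P.d) (y y' : Site P j), y' ≠ y →
      |dKernel ξ⁻¹ ν M y y'| ≤ B' * ((ξ * supDist y y') ^ 2)⁻¹ * Real.exp (-(1 / 2 * (ξ * supDist y y'))))
    (hG : ∀ y y' : Site P j, y' ≠ y → |G y y'| ≤ B * (ξ * supDist y y')⁻¹ * Real.exp (-(1 / 2 * (ξ * supDist y y'))))
    (hg : ∀ y, |g y| ≤ 1) (hg' : ∀ y, |g' y| ≤ 1)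
    (hdx : ∀ y y' : Site P j, |dx μ y y'| ≤ ξ * Site.tdist y y') (y : Site P j) :
    |bracket315 ξ G0 G g g' dx μ y| ≤
      P.d * B * (torusConst * radialConst P.d (1 / 2) ξ 1 + P.d * B' * radialConst P.d (1 / 2) ξ 0) := by
  have hdiag : ∀ z : Site P j, dx μ z z = 0 := fun z => by
    have h := hdx z z
    have h0 : (Site.tdist z z : ℝ) = 0 := by simp [Site.tdist]
    rw [h0, mul_zero] at h
    exact abs_nonpos_iff.mp h
  rw [eq316_bracket_CxiT hξ G0 M G g g' dx μ hG0 hdiag y]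
  exact abs_bracket316_CxiT_le hd hξ hξ1 hN hB hB' M G g g' dx μ hM hG hg hg' hdx y

end

end Literature.MathematicalPhysics.QuantumFieldTheory.Balaban1983to89.B3Bound316Cxi
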